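import Mathlib
import HarnessLib
import Summits.CriticalPhenomena.CardyFormulaZ2.Theorems.CardyMagicRigidityMagicFormulaTStubEntire

/-!
# Line `Sketch` (v8) for crux `MagicFormulaT`, sub-goal CF-a `cf_iteratedDeriv_eq_integral`:
# all `t`-derivatives of the complex-coupling nesting transform commute with the expectation

Crux `Summit.CriticalPhenomena.CardyFormulaZ2.Theses.CardyMagicRigidity.MagicFormulaT`
(stmt-CriticalPhenomena-4836), line `Sketch`, registered skeleton v8, wave-2 sub-goal CF-a.  For an
admissible density `f` (`|f| ≤ C`, `f = 0` off `B̄(0, R)`, `∫ f = 0`) and a mesh `δ > 0`, with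
`F(t, ω) = ∏_u 2cos(t·θ_u(f) + π/3)` (`θ_u(f) = u.nestingPhase f`, loops of `siteLoopConfig δ ω`) and
`Φ_δ(t) = E_{1/2}[F(t, ·)]`, every iterated `t`-derivative passes under the expectation:
`Φ_δ^{(k)}(t) = E_{1/2}[∂_t^k F(t, ·)]` for all `k : ℕ`, `t : ℂ`.

Proof.  A general exchange lemma (`cfx_iteratedDeriv_integral_eq`): if `F : ℂ → Ω → ℂ` is measurable in
`ω`, entire in `t` for every `ω`, and bounded uniformly in `ω` on every disc `‖t‖ ≤ ρ`, then over a finite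
measure all iterated derivatives commute with the integral.  Induction on `k`
(`iteratedDeriv_succ`); the step is `hasDerivAt_integral_of_dominated_loc_of_deriv_le` on the ball
`‖t − t₀‖ < 1`, with: every `∂_t^k F(·, ω)` entire (`Differentiable.contDiff`,
`ContDiff.differentiable_iteratedDeriv'`); `ω ↦ ∂_t^k F(t, ω)` measurable by induction
(`stubEntire_measurable_deriv`); and the uniform domination `‖∂_t^n F(t, ω)‖ ≤ n! · B(‖t₀‖ + 2)` from the
Cauchy estimates on circles of radius `1` (`Complex.norm_iteratedDeriv_le_of_forall_mem_sphere_norm_le`).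
The hypotheses hold for the nesting integrand by the fixed-mesh package of `stub_entire`
(`stubEntire_measurable_integrand`, `stubEntire_hasDerivAt_finprod`, `stubEntire_norm_finprod_le`, with the
deterministic bound `ncard_loops_siteLoopConfig_meeting_le` on the loops meeting `B̄(0, R)`).
No named fact is used; no definition is introduced.
-/

noncomputable section

namespace Summit.CriticalPhenomena.CardyFormulaZ2.Cruxes.MagicFormulaT.LineSketch

open MeasureTheory Filter Set Metric
open scoped Real Topology BigOperators ENNReal
open Literature.Probability.RandomPlanarGeometry Literature.Probability.Percolation
  Literature.Probability.LatticeModels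

/-! ## A general exchange lemma for entire, locally uniformly bounded integrands -/

section Exchange

variable {Ω : Type*} [MeasurableSpace Ω] {F : ℂ → Ω → ℂ}

/-- **Measurability of `ω ↦ ∂_t^k F(t, ω)`** when every `F t` is measurable and every `F(·, ω)` is entire
(induction on `k`: a derivative in the parameter is a limit of measurable difference quotients). -/
theorem cfx_measurable_iteratedDeriv (hmeas : ∀ t, Measurable (F t))
    (hdiff : ∀ ω, Differentiable ℂ (fun t ↦ F t ω)) (k : ℕ) (t : ℂ) :
    Measurable fun ω ↦ iteratedDeriv k (fun s ↦ F s ω) t := by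
  induction k generalizing t with
  | zero => simpa only [iteratedDeriv_zero] using hmeas t
  | succ k ih =>
    simp only [iteratedDeriv_succ]
    exact stubEntire_measurable_deriv (F := fun t ω ↦ iteratedDeriv k (fun s ↦ F s ω) t) ih t
      fun ω ↦ (hdiff ω).contDiff.differentiable_iteratedDeriv' k t

/-- **Each iterated derivative of an entire function is the derivative of the previous one**, pointwise. -/
theorem cfx_hasDerivAt_iteratedDeriv {g : ℂ → ℂ} (hg : Differentiable ℂ g) (k : ℕ) (t : ℂ) :
    HasDerivAt (iteratedDeriv k g) (iteratedDeriv (k + 1) g t) t := by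
  rw [iteratedDeriv_succ]
  exact (hg.contDiff.differentiable_iteratedDeriv' k t).hasDerivAt

/-- **Cauchy estimate on circles of radius `1`**: if the entire `g` has `‖g z‖ ≤ B` on `‖z‖ ≤ ρ`, then
`‖g^{(k)}(t)‖ ≤ k! · B` whenever `‖t‖ + 1 ≤ ρ`. -/
theorem cfx_norm_iteratedDeriv_le {g : ℂ → ℂ} (hg : Differentiable ℂ g) {ρ B : ℝ}
    (hB : ∀ z, ‖z‖ ≤ ρ → ‖g z‖ ≤ B) (k : ℕ) {t : ℂ} (ht : ‖t‖ + 1 ≤ ρ) :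
    ‖iteratedDeriv k g t‖ ≤ k.factorial * B := by
  have hS : ∀ z ∈ sphere t 1, ‖g z‖ ≤ B := fun z hz ↦ hB z <| by
    have h1 : ‖z - t‖ = 1 := mem_sphere_iff_norm.1 hz
    calc ‖z‖ = ‖z - t + t‖ := by rw [sub_add_cancel]
      _ ≤ ‖z - t‖ + ‖t‖ := norm_add_le _ _
      _ ≤ ρ := by linarith
  simpa using Complex.norm_iteratedDeriv_le_of_forall_mem_sphere_norm_le k one_pos hg.diffContOnCl hS

variable (P : Measure Ω) [IsFiniteMeasure P]

/-- **One derivative under the integral sign for `∂_t^k F`**: over a finite measure, for `F` measurable in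
`ω`, entire in `t` and bounded uniformly in `ω` on bounded `t`-sets, `t ↦ ∫ ∂_t^k F(t, ω)` has derivative
`∫ ∂_t^{k+1} F(t₀, ω)` at every `t₀` (dominated differentiation on the ball `‖t − t₀‖ < 1`, domination by
the Cauchy estimates at radius `‖t₀‖ + 2`). -/
theorem cfx_hasDerivAt_integral_iteratedDeriv (hmeas : ∀ t, Measurable (F t))
    (hdiff : ∀ ω, Differentiable ℂ (fun t ↦ F t ω))
    (hbd : ∀ ρ : ℝ, ∃ B : ℝ, ∀ ω t, ‖t‖ ≤ ρ → ‖F t ω‖ ≤ B) (k : ℕ) (t₀ : ℂ) :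
    HasDerivAt (fun t ↦ ∫ ω, iteratedDeriv k (fun s ↦ F s ω) t ∂P)
      (∫ ω, iteratedDeriv (k + 1) (fun s ↦ F s ω) t₀ ∂P) t₀ := by
  obtain ⟨B, hB⟩ := hbd (‖t₀‖ + 2)
  have hbdG : ∀ n ω t, ‖t‖ + 1 ≤ ‖t₀‖ + 2 →
      ‖iteratedDeriv n (fun s ↦ F s ω) t‖ ≤ n.factorial * B :=
    fun n ω t ht ↦ cfx_norm_iteratedDeriv_le (hdiff ω) (fun z hz ↦ hB ω z hz) n ht
  refine (hasDerivAt_integral_of_dominated_loc_of_deriv_le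
    (F := fun t ω ↦ iteratedDeriv k (fun s ↦ F s ω) t)
    (F' := fun t ω ↦ iteratedDeriv (k + 1) (fun s ↦ F s ω) t)
    (bound := fun _ ↦ ((k + 1).factorial : ℝ) * B) (ball_mem_nhds t₀ one_pos)
    (Eventually.of_forall fun t ↦ (cfx_measurable_iteratedDeriv hmeas hdiff k t).aestronglyMeasurable)
    ?_ (cfx_measurable_iteratedDeriv hmeas hdiff (k + 1) t₀).aestronglyMeasurable
    (Eventually.of_forall fun ω t ht ↦ hbdG (k + 1) ω t ?_) (integrable_const _)
    (Eventually.of_forall fun ω t _ ↦ cfx_hasDerivAt_iteratedDeriv (hdiff ω) k t)).2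
  · exact Integrable.mono' (integrable_const ((k.factorial : ℝ) * B))
      (cfx_measurable_iteratedDeriv hmeas hdiff k t₀).aestronglyMeasurable
      (Eventually.of_forall fun ω ↦ hbdG k ω t₀ (by linarith))
  · linarith [norm_lt_of_mem_ball ht]

/-- **All iterated derivatives commute with the integral** for an integrand measurable in `ω`, entire in
`t` and bounded uniformly in `ω` on bounded `t`-sets, over a finite measure (induction on `k` with
`iteratedDeriv_succ` and `cfx_hasDerivAt_integral_iteratedDeriv`). -/
theorem cfx_iteratedDeriv_integral_eq (hmeas : ∀ t, Measurable (F t))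
    (hdiff : ∀ ω, Differentiable ℂ (fun t ↦ F t ω))
    (hbd : ∀ ρ : ℝ, ∃ B : ℝ, ∀ ω t, ‖t‖ ≤ ρ → ‖F t ω‖ ≤ B) (k : ℕ) :
    iteratedDeriv k (fun t ↦ ∫ ω, F t ω ∂P) = fun t ↦ ∫ ω, iteratedDeriv k (fun s ↦ F s ω) t ∂P := by
  induction k with
  | zero => simp only [iteratedDeriv_zero]
  | succ k ih =>
    rw [iteratedDeriv_succ, ih]
    funext t₀
    exact (cfx_hasDerivAt_integral_iteratedDeriv P hmeas hdiff hbd k t₀).deriv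

end Exchange

/-! ## The registered sub-goal -/

/-- **Sub-goal CF-a (`cf_iteratedDeriv_eq_integral`) · exchange of all `t`-derivatives with the
expectation at fixed mesh.**  For every admissible `f`, mesh `δ > 0`, order `k` and coupling `t ∈ ℂ`:
`∂_t^k E_{1/2}[∏_u 2cos(t·θ_u(f) + π/3)] = E_{1/2}[∂_t^k ∏_u 2cos(t·θ_u(f) + π/3)]`.
At fixed mesh finitely many loops meet `B̄(0, R)` (a deterministic number `N(δ, R)`), so the integrand is,
for every `ω`, a finite product of entire factors bounded by `(2e^{ρK+2})^N` on `‖t‖ ≤ ρ`; apply the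
general exchange lemma `cfx_iteratedDeriv_integral_eq`. -/
theorem cf_iteratedDeriv_eq_integral : ∀ (f : ℂ → ℝ) (R C : ℝ), Measurable f → (∀ z, |f z| ≤ C) →
    (∀ z, R < ‖z‖ → f z = 0) → ∫ z, f z = 0 → ∀ δ : ℝ, 0 < δ → ∀ (k : ℕ) (t : ℂ),
    iteratedDeriv k (fun t : ℂ ↦ ∫ ω, (∏ᶠ u ∈ (siteLoopConfig δ ω).loops,
      2 * Complex.cos (t * ((u.nestingPhase f : ℝ) : ℂ) + (Real.pi : ℂ) / 3)) ∂(triSitePercolation half)) t =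
    ∫ ω, iteratedDeriv k (fun t : ℂ ↦ ∏ᶠ u ∈ (siteLoopConfig δ ω).loops,
      2 * Complex.cos (t * ((u.nestingPhase f : ℝ) : ℂ) + (Real.pi : ℂ) / 3)) t ∂(triSitePercolation half) := by
  intro f R C _ hC hR h0 δ hδ k t
  have hfin := fun ω : SiteConfig (Site 2) ↦ (ncard_loops_siteLoopConfig_meeting_le hδ R ω).1
  have hN := fun ω : SiteConfig (Site 2) ↦ (ncard_loops_siteLoopConfig_meeting_le hδ R ω).2
  have h := cfx_iteratedDeriv_integral_eq (triSitePercolation half)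
    (F := fun t ω ↦ ∏ᶠ u ∈ (siteLoopConfig δ ω).loops,
      2 * Complex.cos (t * ((u.nestingPhase f : ℝ) : ℂ) + (Real.pi : ℂ) / 3))
    (fun t ↦ stubEntire_measurable_integrand hR h0 hδ t)
    (fun ω t ↦ (stubEntire_hasDerivAt_finprod hR h0 (hfin ω) t).differentiableAt)
    (fun ρ ↦ ⟨_, fun ω t ht ↦ (stubEntire_norm_finprod_le hC hR h0 (hfin ω) (hN ω) (ρ := ρ) ht).1⟩) k
  exact congr_fun h t

end Summit.CriticalPhenomena.CardyFormulaZ2.Cruxes.MagicFormulaT.LineSketch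

end
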